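import Literature.MathematicalPhysics.QuantumLattice.HubbardTTPrimeThermalWindowCertificateSymm
import Literature.MathematicalPhysics.QuantumLattice.HubbardTTPrimeWindowCertificateConvexComb
import HarnessLib

/-!
# Convex combinations of THERMAL `t–t'` window certificates: corner certificates of a box in
# `(t', U)` at one temperature certify every point of the box (the `T > 0` vertex rule)

Family `hubbard` (topic `MathematicalPhysics/QuantumLattice`); the positive-temperature twin of
`HubbardTTPrimeWindowCertificateConvexComb` (the `T = 0` vertex rule of the Hubbard fast layer). Written
for the material-oracle stage S2 (cell `pub/hubbard-downfold`, seat unc-3: a downfolded parameter BOX in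
`(t'/t, U/t)` times a temperature must map to a certified word; HUMAN RULING D-0096 «T > 0»). When thermal
certificates exist at ALL CORNERS of a box, the vertex rule covers the box WITHOUT the charge losses of
anchor transport (`HubbardTTPrimeThermalWindowCertificateAnchorTransport`,
`HubbardTTPrimeThermalWindowCertificateTemperatureTransport`): it is the sharp «points → boxes»
device, transport the fallback.

The object is the full-symmetry THERMAL certificate of `HubbardTTPrimeThermalWindowCertificateSymm`
(Fawzi–Fawzi–Scalet's EEB-constrained relaxation read through its rounded dual; reader
`IsTorusLimitOfMixture.re_expect_ge_of_thermal_certificate_symm_TT'_of_sectorGibbs`). Its rows whose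
OPERATORS carry the couplings are the eom rows `[H_{Λ'}(t',U), ΓBₖ]`, the energy row
`κ(u·1 − ΓE_{Φ(t,t',U)})`, the energy–entropy-balance rows `λᵣ(β(ΓAᵣ)ᴴ[H_{Λ'}(t',U), ΓAᵣ] − sᵣAᴴA + qᵣAAᴴ)`
and coupling-affine extra rows `κₑ(G⁰ₑ + t' G^Tₑ + U G^Dₑ)` (e.g. the matrix cuts of
`TorusGibbsMatrixCuts`, whose commutator part is linear in the Hamiltonian); all are AFFINE in `(t', U)`.
Consequently corner certificates at `(t'ᵢ, Uᵢ)`, `i ∈ I`, at a common `β`, which SHARE the objective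
`Xw`, the multiplier `κ`, `ν`, the Gram basis `O`, the eom generators `Bₖ`, the symmetry data, the EEB data
`(λᵣ, Aᵣ, sᵣ, qᵣ)` and the extra-row family `(κₑ, G⁰ₑ, G^Tₑ, G^Dₑ)`, with FREE `cᵢ, uᵢ, μᵢ`, Gram matrices
`Λmᵢ ⪰ 0`, defect / charged-word / spin-flip / null data `Yᵢ, bᵢ, Yfᵢ, Nzᵢ` and residual data `dcᵢ, aᵢ`,
COMBINE under convex weights `wᵢ ≥ 0`, `Σ wᵢ = 1` into a thermal certificate of the same shape at the
barycentre `(Σ wᵢ t'ᵢ, Σ wᵢ Uᵢ)` (same `β`) with averaged data (§0: `sum_smul_eebRow`,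
`sum_smul_affineRow`; the Gram, eom, energy and null blocks combine as in the `T = 0` file). One
application of the reader there gives (§1), for every thermal torus limit `ω` at the barycentre (canonical
`(rectN n L, S^z = 0)`-sector Gibbs states at inverse temperature `β`, `0 ≤ n ≤ 2`):

  `Σ wᵢ cᵢ − Σₖ ‖Σᵢ wᵢ aᵢₖ‖ + (Σ_σ Σᵢ wᵢ μᵢσ)(n/2 − ν) + κ(Σ wᵢ uᵢ − e^{t t̄' Ū}(ω)) ≤ Re ω_{Λ'}(Xw)`

(`IsTorusLimitOfMixture.re_expect_ge_of_thermal_certificates_convexComb_symm_TT'_of_sectorGibbs`;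
weighted-corner form `…_weighted_of_sectorGibbs` by `‖Σ w a‖ ≤ Σ w ‖a‖`; `…_weighted_at_of_sectorGibbs`
takes a prescribed target `(t', U')` with the barycentre identities as hypotheses). Why the sharing
pattern is forced: as at `T = 0` (planner-p1 TARGET §3.4′: the couplings sit inside the OPERATORS of the
eom and energy rows) plus the EEB rows — `Σᵢ wᵢ λᵣ β Aᴴ[Hᵢ, A] = λᵣ β Aᴴ[Σᵢ wᵢ Hᵢ, A]` needs the SAME
`λᵣ, Aᵣ` at every corner, and the temperature-free parts `−sᵣAᴴA + qᵣAAᴴ` need `Σ wᵢ = 1`.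

HONEST SCOPE: bookkeeping only — no number, no new certificate, no claim on the Hubbard model's phases;
same `β` at all corners (the temperature leg is `HubbardTTPrimeThermalWindowCertificateTemperatureTransport`);
the charged-generator caveat and the torus-limit thermal convention of the reader unchanged; the
barycentre extra rows are hypotheses BY NAME (matrix cuts:
`IsTorusLimitOfMixture.re_expect_matrixCut_nonneg_of_sectorGibbs_of_thicken_subset` at the barycentre).
WHAT THIS IS NOT: a certificate or a phase sentence. Everything is PROVED; no definition, no named fact,
no numerical input.

## Mathlib / tree search

REUSED: `hubbardTTPrimeFermionInteraction_convexComb`, `FermionInteraction.localHamiltonian_of_sum`,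
`FermionInteraction.meanEnergyObs_of_sum`, `gramForm_sum_smul` (`HubbardTTPrimeWindowCertificateConvexComb`
§1), `IsTorusLimitOfMixture.re_expect_ge_of_thermal_certificate_symm_TT'_of_sectorGibbs`
(`HubbardTTPrimeThermalWindowCertificateSymm`), Mathlib `Matrix.posSemidef_sum`, `norm_sum_le`.
`lean search 'thermal_certificates_convexComb|ThermalWindowCertificateConvexComb'`: nothing; the `T = 0`
vertex rule is `IsTorusLimitOf.re_expect_ge_of_window_certificates_convexComb_TT'_ineq`.

## References

* H. Fawzi, O. Fawzi, S. O. Scalet (2024), §3.2 (opt2), Thm. 3.6 (EEB-constrained relaxations bound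
  every KMS state; the rows are linear in the Hamiltonian). [cite: FawziFawziScalet2024, Thm. 3.6]
* X. Han, *Quantum many-body bootstrap*, arXiv:2006.06002 (2020), §2–§3. [cite: Han2020Bootstrap, §3]
* J. Wang et al., PRX 14 (2024) 031006, §III (observable bounds under linear constraints).
  [cite: WangEtAl2024, §III]
* O. Bratteli, A. Kishimoto, D. W. Robinson, CMP 64 (1978) 41, §3 (mean energy is linear in the
  interaction). [cite: BratteliKishimotoRobinson1978, §3 (mean energy functional)]
-/

noncomputable section

namespace Literature.MathematicalPhysics.QuantumLattice

open Matrix Finset HubbardWave0 Literature.Probability.LatticeModels ThermodynamicLimit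
open Literature.MathematicalPhysics.QuantumManyBody.StateRelaxation
open _root_.Filter
open scoped _root_.Topology ComplexOrder BigOperators

/-! ### §0 Two averaging lemmas: the EEB row and a coupling-affine extra row under convex weights -/

/-- **Convex combinations of EEB rows with SHARED data**: `Σᵢ wᵢ·λ(β Eᴴ[Hᵢ,E] − s EᴴE + q EEᴴ) =
λ(β Eᴴ[Σᵢ wᵢHᵢ, E] − s EᴴE + q EEᴴ)` when `Σ wᵢ = 1` (the commutator is linear in the Hamiltonian).
[cite: FawziFawziScalet2024, §3.2] -/
theorem sum_smul_eebRow {Λ' : Finset (Site 2)} {ι₀ : Type*} (I : Finset ι₀) (w : ι₀ → ℂ)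
    (hw1 : ∑ i ∈ I, w i = 1) (H : ι₀ → FermionOp Λ') (E : FermionOp Λ') (lamc βc sc qc : ℂ) :
    ∑ i ∈ I, w i • (lamc • (βc • (Eᴴ * (H i * E - E * H i)) - sc • (Eᴴ * E) + qc • (E * Eᴴ))) =
      lamc • (βc • (Eᴴ * ((∑ i ∈ I, w i • H i) * E - E * (∑ i ∈ I, w i • H i))) -
        sc • (Eᴴ * E) + qc • (E * Eᴴ)) := by
  have hc : Eᴴ * ((∑ i ∈ I, w i • H i) * E - E * (∑ i ∈ I, w i • H i)) =
      ∑ i ∈ I, w i • (Eᴴ * (H i * E - E * H i)) := by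
    rw [Finset.sum_mul, Finset.mul_sum, ← Finset.sum_sub_distrib, Finset.mul_sum]
    refine Finset.sum_congr rfl fun i _ => ?_
    rw [smul_mul_assoc, mul_smul_comm, ← smul_sub, mul_smul_comm]
  have hS : ∑ i ∈ I, w i • (lamc • (-(sc • (Eᴴ * E)) + qc • (E * Eᴴ))) =
      lamc • (-(sc • (Eᴴ * E)) + qc • (E * Eᴴ)) := by
    rw [← Finset.sum_smul, hw1, one_smul]
  have hsplit : ∀ i ∈ I, w i • (lamc • (βc • (Eᴴ * (H i * E - E * H i)) - sc • (Eᴴ * E) + qc • (E * Eᴴ))) =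
      (lamc * βc) • (w i • (Eᴴ * (H i * E - E * H i))) +
        w i • (lamc • (-(sc • (Eᴴ * E)) + qc • (E * Eᴴ))) := by
    intro i _
    module
  rw [Finset.sum_congr rfl hsplit, Finset.sum_add_distrib, ← Finset.smul_sum, hS, ← hc]
  module

/-- **Convex combinations of a coupling-affine row**: `Σᵢ wᵢ (G⁰ + t'ᵢ G^T + Uᵢ G^D) =
G⁰ + (Σ wᵢt'ᵢ) G^T + (Σ wᵢUᵢ) G^D` when `Σ wᵢ = 1`. [folklore] [cite: FawziFawziScalet2024, §3.3] -/
theorem sum_smul_affineRow {Λ' : Finset (Site 2)} {ι₀ : Type*} (I : Finset ι₀) (w : ι₀ → ℂ)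
    (hw1 : ∑ i ∈ I, w i = 1) (tpc Uc : ι₀ → ℂ) (G0 GT' GD' : FermionOp Λ') :
    ∑ i ∈ I, w i • (G0 + tpc i • GT' + Uc i • GD') =
      G0 + (∑ i ∈ I, w i * tpc i) • GT' + (∑ i ∈ I, w i * Uc i) • GD' := by
  simp_rw [smul_add, Finset.sum_add_distrib, smul_smul]
  rw [← Finset.sum_smul, hw1, one_smul, ← Finset.sum_smul, ← Finset.sum_smul]

namespace InfVolFermionState

/-! ### §1 The convex combination of corner THERMAL certificates -/

/-- **Thermal box certificate (vertex rule at `T > 0`).** Corner thermal certificates at `(t'ᵢ, Uᵢ)`,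
`i ∈ I`, same `β`, sharing `Xw`, `κ`, `ν`, the Gram basis `O`, the eom generators `B`, the symmetry data
`(γ, wv)`, the word lists, the EEB data `(λ, A, s, q)` and the coupling-affine extra-row family
`(κₑ, G⁰, G^T, G^D)`, with free `cᵢ, uᵢ, μᵢ, Λmᵢ ⪰ 0, Yᵢ, bᵢ, Yfᵢ, Nzᵢ, dcᵢ, aᵢ`, and convex weights
`wᵢ ≥ 0`, `Σ wᵢ = 1`: for every thermal torus limit `ω` at the barycentre `(Σ wᵢ t'ᵢ, Σ wᵢ Uᵢ)`
(canonical sector Gibbs states at `β`, `0 ≤ n ≤ 2`, `Ls → ∞`) killing every corner's null operators and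
nonnegative on the barycentre extra rows,
`Σ wᵢ cᵢ − Σₖ ‖Σᵢ wᵢ aᵢₖ‖ + (Σ_σ Σᵢ wᵢ μᵢσ)(n/2 − ν) + κ(Σ wᵢ uᵢ − e^{t t̄' Ū}(ω)) ≤ Re ω_{Λ'}(Xw)`.
[cite: FawziFawziScalet2024, Thm. 3.6] [cite: WangEtAl2024, §III] -/
theorem IsTorusLimitOfMixture.re_expect_ge_of_thermal_certificates_convexComb_symm_TT'_of_sectorGibbs
    (t : ℝ) {ι₀ : Type*} (I : Finset ι₀) (w : ι₀ → ℝ) (hw0 : ∀ i ∈ I, 0 ≤ w i)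
    (hw1 : ∑ i ∈ I, w i = 1) (tp U u c : ι₀ → ℝ)
    {n : ℝ} (hn0 : 0 ≤ n) (hn2 : n ≤ 2) (β : ℝ)
    {ω : InfVolFermionState 2} {Ls : ℕ → ℕ}
    (h : ω.IsTorusLimitOfMixture (sectorGibbsCount n)
      (fun L => sectorGibbsWeightTT' β t (∑ i ∈ I, w i * tp i) (∑ i ∈ I, w i * U i) n L)
      (fun L => sectorGibbsVectorTT' t (∑ i ∈ I, w i * tp i) (∑ i ∈ I, w i * U i) n L) Ls)
    (hLs : Tendsto Ls atTop atTop)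
    {Λ Λ' : Finset (Site 2)} (hΛ : Λ ⊆ Λ') (h8 : thicken Λ 1 ⊆ Λ')
    (h0 : thicken ({0} : Finset (Site 2)) 1 ⊆ Λ') (hz : (0 : Site 2) ∈ Λ')
    (Xw : FermionOp Λ') (κ : ℝ) (μ : ι₀ → Fin 2 → ℝ) (ν : ℝ)
    {m : Type*} [Fintype m] [DecidableEq m] (Λm : ι₀ → Matrix m m ℂ)
    (hΛm : ∀ i ∈ I, (Λm i).PosSemidef) (O : m → FermionOp Λ')
    {κ' : Type*} (s : Finset κ') (B : κ' → FermionOp Λ)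
    {ι : Type*} (tt : Finset ι) (γ : ι → DihedralGroup 4) (wv : ι → Site 2)
    (hsh : ∀ l, d4ShiftSet (γ l) (wv l) Λ ⊆ Λ') (Y : ι₀ → ι → FermionOp Λ)
    {ρ : Type*} (uu : Finset ρ) (b : ι₀ → ρ → ℂ) (cw : ρ → List (Orb (PolySite Λ') × Bool))
    (hcw : ∀ j ∈ uu, ladderCharge (cw j) ≠ 0 ∨ ladderSpinCharge (cw j) ≠ 0)
    {φ : Type*} (ff : Finset φ) (Yf : ι₀ → φ → FermionOp Λ')
    {ζ : Type*} (zz : Finset ζ) (Nz : ι₀ → ζ → FermionOp Λ')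
    (hnull : ∀ i ∈ I, ∀ z ∈ zz, ω.expect Λ' (Nz i z) = 0)
    {θ : Type*} (rr : Finset θ) (lam : θ → ℝ) (hlam : ∀ r ∈ rr, 0 ≤ lam r) (A : θ → FermionOp Λ)
    (hAN : ∀ r ∈ rr, Commute (A r) (totalNumber : FermionOp Λ))
    (hAS : ∀ r ∈ rr, Commute (A r) (HubbardWave0.spinZ : FermionOp Λ))
    (sv qv : θ → ℝ) (hq : ∀ r ∈ rr, Real.exp (sv r - 1) ≤ qv r)
    {η : Type*} (gg : Finset η) (kap : η → ℝ) (hkap : ∀ e ∈ gg, 0 ≤ kap e) (G₀ GT GD : η → FermionOp Λ')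
    (hG : ∀ e ∈ gg, 0 ≤ (ω.expect Λ'
      (G₀ e + (((∑ i ∈ I, w i * tp i) : ℝ) : ℂ) • GT e + (((∑ i ∈ I, w i * U i) : ℝ) : ℂ) • GD e)).re)
    {δ : Type*} (ah : Finset δ) (dc : ι₀ → δ → ℝ) (V : δ → FermionOp Λ')
    {κ'' : Type*} (wd : Finset κ'') (a : ι₀ → κ'' → ℂ)
    (word : κ'' → List (Orb (PolySite Λ') × Bool))
    (hcert : ∀ i ∈ I, Xw - ((c i : ℝ) : ℂ) • (1 : FermionOp Λ') -
        ∑ σ : Fin 2, ((μ i σ : ℝ) : ℂ) • (nAt 0 hz σ - ((ν : ℝ) : ℂ) • (1 : FermionOp Λ')) -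
        ((κ : ℝ) : ℂ) • (((u i : ℝ) : ℂ) • (1 : FermionOp Λ') -
          fermionEmbed (PolySite.incl h0) ((hubbardTTPrimeFermionInteraction t (tp i) (U i)).meanEnergyObs 1)) =
      gramForm (Λm i) O +
        (∑ k ∈ s, ((hubbardTTPrimeFermionInteraction t (tp i) (U i)).localHamiltonian Λ' * fermionEmbed (PolySite.incl hΛ) (B k) - fermionEmbed (PolySite.incl hΛ) (B k) * (hubbardTTPrimeFermionInteraction t (tp i) (U i)).localHamiltonian Λ') +
          ∑ l ∈ tt, (fermionEmbed (PolySite.incl (hsh l)) (fermionEmbed (PolySite.d4Emb (γ l) (wv l) Λ) (Y i l)) -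
            fermionEmbed (PolySite.incl hΛ) (Y i l)) +
          ∑ j ∈ uu, (b i j) • ladderWord (cw j) +
          ∑ f ∈ ff, (relabel (Orb.spinSwap : Orb (PolySite Λ') ≃ Orb (PolySite Λ')) (Yf i f) - (Yf i f)) +
          ∑ z ∈ zz, (Nz i z)) +
        (∑ r ∈ rr, ((lam r : ℝ) : ℂ) •
            (((β : ℝ) : ℂ) • ((fermionEmbed (PolySite.incl hΛ) (A r))ᴴ *
                ((hubbardTTPrimeFermionInteraction t (tp i) (U i)).localHamiltonian Λ' * fermionEmbed (PolySite.incl hΛ) (A r) - fermionEmbed (PolySite.incl hΛ) (A r) * (hubbardTTPrimeFermionInteraction t (tp i) (U i)).localHamiltonian Λ')) -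
              ((sv r : ℝ) : ℂ) • ((fermionEmbed (PolySite.incl hΛ) (A r))ᴴ * fermionEmbed (PolySite.incl hΛ) (A r)) +
              ((qv r : ℝ) : ℂ) • (fermionEmbed (PolySite.incl hΛ) (A r) * (fermionEmbed (PolySite.incl hΛ) (A r))ᴴ)) +
          ∑ e ∈ gg, ((kap e : ℝ) : ℂ) • (G₀ e + ((tp i : ℝ) : ℂ) • GT e + ((U i : ℝ) : ℂ) • GD e)) +
        (∑ m' ∈ ah, ((dc i m' : ℝ) : ℂ) • ((V m')ᴴ - V m') + ∑ k ∈ wd, (a i k) • ladderWord (word k))) :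
    ∑ i ∈ I, w i * c i - ∑ k ∈ wd, ‖∑ i ∈ I, ((w i : ℝ) : ℂ) * a i k‖ +
        (∑ σ : Fin 2, ∑ i ∈ I, w i * μ i σ) * (n / 2 - ν) +
        κ * (∑ i ∈ I, w i * u i - ω.meanEnergy (hubbardTTPrimeFermionInteraction t (∑ i ∈ I, w i * tp i) (∑ i ∈ I, w i * U i)) 1) ≤
      (ω.expect Λ' Xw).re := by
  -- the interaction at the barycentre is the weighted sum of the corner interactions
  have hΦ : ∀ X, (hubbardTTPrimeFermionInteraction t (∑ i ∈ I, w i * tp i) (∑ i ∈ I, w i * U i)).Φ X =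
      ∑ i ∈ I, ((w i : ℝ) : ℂ) • (hubbardTTPrimeFermionInteraction t (tp i) (U i)).Φ X := fun X =>
    hubbardTTPrimeFermionInteraction_convexComb I w hw1 t tp U X
  have hH := FermionInteraction.localHamiltonian_of_sum hΦ Λ'
  have hE := FermionInteraction.meanEnergyObs_of_sum hΦ 1
  -- shorthand for the corner and barycentre objects
  set Φb := (hubbardTTPrimeFermionInteraction t (∑ i ∈ I, w i * tp i) (∑ i ∈ I, w i * U i)) with hΦb
  set Hi : ι₀ → FermionOp Λ' := fun i => (hubbardTTPrimeFermionInteraction t (tp i) (U i)).localHamiltonian Λ' with hHi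
  set Ei : ι₀ → FermionOp (thicken ({0} : Finset (Site 2)) 1) := fun i => (hubbardTTPrimeFermionInteraction t (tp i) (U i)).meanEnergyObs 1 with hEi
  have hH' : Φb.localHamiltonian Λ' = ∑ i ∈ I, ((w i : ℝ) : ℂ) • Hi i := hH
  have hE' : Φb.meanEnergyObs 1 = ∑ i ∈ I, ((w i : ℝ) : ℂ) • Ei i := hE
  -- averaged data
  have hΛbar : (∑ i ∈ I, ((w i : ℝ) : ℂ) • Λm i).PosSemidef :=
    Matrix.posSemidef_sum I fun i hi => (hΛm i hi).smul (Complex.zero_le_real.2 (hw0 i hi))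
  have hw1C : ∑ i ∈ I, ((w i : ℝ) : ℂ) = 1 := by
    rw [← Complex.ofReal_sum, hw1, Complex.ofReal_one]
  have htpC : ∑ i ∈ I, ((w i : ℝ) : ℂ) * ((tp i : ℝ) : ℂ) = ((∑ i ∈ I, w i * tp i : ℝ) : ℂ) := by
    rw [Complex.ofReal_sum]
    exact Finset.sum_congr rfl fun i _ => by rw [Complex.ofReal_mul]
  have hUC : ∑ i ∈ I, ((w i : ℝ) : ℂ) * ((U i : ℝ) : ℂ) = ((∑ i ∈ I, w i * U i : ℝ) : ℂ) := by
    rw [Complex.ofReal_sum]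
    exact Finset.sum_congr rfl fun i _ => by rw [Complex.ofReal_mul]
  -- §A the left-hand sides combine
  have hl : ∑ i ∈ I, ((w i : ℝ) : ℂ) • (Xw - ((c i : ℝ) : ℂ) • (1 : FermionOp Λ') -
        ∑ σ : Fin 2, ((μ i σ : ℝ) : ℂ) • (nAt 0 hz σ - ((ν : ℝ) : ℂ) • (1 : FermionOp Λ')) -
        ((κ : ℝ) : ℂ) • (((u i : ℝ) : ℂ) • (1 : FermionOp Λ') - fermionEmbed (PolySite.incl h0) (Ei i))) =
      Xw - (((∑ i ∈ I, w i * c i : ℝ)) : ℂ) • (1 : FermionOp Λ') -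
        ∑ σ : Fin 2, (((∑ i ∈ I, w i * μ i σ : ℝ)) : ℂ) • (nAt 0 hz σ - ((ν : ℝ) : ℂ) • (1 : FermionOp Λ')) -
        ((κ : ℝ) : ℂ) • ((((∑ i ∈ I, w i * u i : ℝ)) : ℂ) • (1 : FermionOp Λ') -
          fermionEmbed (PolySite.incl h0) (Φb.meanEnergyObs 1)) := by
    have P1 : ∑ i ∈ I, ((w i : ℝ) : ℂ) • Xw = Xw := by
      rw [← Finset.sum_smul, hw1C, one_smul]
    have P2 : ∑ i ∈ I, ((w i : ℝ) : ℂ) • (((c i : ℝ) : ℂ) • (1 : FermionOp Λ')) =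
        (((∑ i ∈ I, w i * c i : ℝ)) : ℂ) • (1 : FermionOp Λ') := by
      simp_rw [smul_smul]
      rw [← Finset.sum_smul, Complex.ofReal_sum]
      simp_rw [Complex.ofReal_mul]
    have P3 : ∑ i ∈ I, ((w i : ℝ) : ℂ) •
          ∑ σ : Fin 2, ((μ i σ : ℝ) : ℂ) • (nAt 0 hz σ - ((ν : ℝ) : ℂ) • (1 : FermionOp Λ')) =
        ∑ σ : Fin 2, (((∑ i ∈ I, w i * μ i σ : ℝ)) : ℂ) •
          (nAt 0 hz σ - ((ν : ℝ) : ℂ) • (1 : FermionOp Λ')) := by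
      simp_rw [Finset.smul_sum, smul_smul]
      rw [Finset.sum_comm]
      refine Finset.sum_congr rfl fun σ _ => ?_
      rw [← Finset.sum_smul, Complex.ofReal_sum]
      simp_rw [Complex.ofReal_mul]
    have P4 : ∑ i ∈ I, ((w i : ℝ) : ℂ) • (((κ : ℝ) : ℂ) •
          (((u i : ℝ) : ℂ) • (1 : FermionOp Λ') - fermionEmbed (PolySite.incl h0) (Ei i))) =
        ((κ : ℝ) : ℂ) • ((((∑ i ∈ I, w i * u i : ℝ)) : ℂ) • (1 : FermionOp Λ') -
          fermionEmbed (PolySite.incl h0) (Φb.meanEnergyObs 1)) := by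
      simp_rw [smul_comm ((w _ : ℝ) : ℂ) ((κ : ℝ) : ℂ)]
      rw [← Finset.smul_sum]
      congr 1
      simp_rw [smul_sub]
      rw [Finset.sum_sub_distrib]
      congr 1
      · simp_rw [smul_smul]
        rw [← Finset.sum_smul, Complex.ofReal_sum]
        simp_rw [Complex.ofReal_mul]
      · rw [hE', map_sum]
        exact Finset.sum_congr rfl fun i _ => by rw [map_smul]
    have hdist : ∀ i ∈ I, ((w i : ℝ) : ℂ) • (Xw - ((c i : ℝ) : ℂ) • (1 : FermionOp Λ') -
          ∑ σ : Fin 2, ((μ i σ : ℝ) : ℂ) • (nAt 0 hz σ - ((ν : ℝ) : ℂ) • (1 : FermionOp Λ')) -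
          ((κ : ℝ) : ℂ) • (((u i : ℝ) : ℂ) • (1 : FermionOp Λ') - fermionEmbed (PolySite.incl h0) (Ei i))) =
        ((w i : ℝ) : ℂ) • Xw - ((w i : ℝ) : ℂ) • (((c i : ℝ) : ℂ) • (1 : FermionOp Λ')) -
          ((w i : ℝ) : ℂ) • ∑ σ : Fin 2, ((μ i σ : ℝ) : ℂ) • (nAt 0 hz σ - ((ν : ℝ) : ℂ) • (1 : FermionOp Λ')) -
          ((w i : ℝ) : ℂ) • (((κ : ℝ) : ℂ) •
            (((u i : ℝ) : ℂ) • (1 : FermionOp Λ') - fermionEmbed (PolySite.incl h0) (Ei i))) := by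
      intro i _
      rw [smul_sub, smul_sub, smul_sub]
    rw [Finset.sum_congr rfl hdist, Finset.sum_sub_distrib, Finset.sum_sub_distrib,
      Finset.sum_sub_distrib, P1, P2, P3, P4]
  -- §B the right-hand sides combine
  have hr : ∑ i ∈ I, ((w i : ℝ) : ℂ) • (gramForm (Λm i) O +
        (∑ k ∈ s, (Hi i * fermionEmbed (PolySite.incl hΛ) (B k) - fermionEmbed (PolySite.incl hΛ) (B k) * Hi i) +
          ∑ l ∈ tt, (fermionEmbed (PolySite.incl (hsh l)) (fermionEmbed (PolySite.d4Emb (γ l) (wv l) Λ) (Y i l)) -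
            fermionEmbed (PolySite.incl hΛ) (Y i l)) +
          ∑ j ∈ uu, (b i j) • ladderWord (cw j) +
          ∑ f ∈ ff, (relabel (Orb.spinSwap : Orb (PolySite Λ') ≃ Orb (PolySite Λ')) (Yf i f) - (Yf i f)) +
          ∑ z ∈ zz, (Nz i z)) +
        (∑ r ∈ rr, ((lam r : ℝ) : ℂ) •
            (((β : ℝ) : ℂ) • ((fermionEmbed (PolySite.incl hΛ) (A r))ᴴ * (Hi i * fermionEmbed (PolySite.incl hΛ) (A r) - fermionEmbed (PolySite.incl hΛ) (A r) * Hi i)) -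
              ((sv r : ℝ) : ℂ) • ((fermionEmbed (PolySite.incl hΛ) (A r))ᴴ * fermionEmbed (PolySite.incl hΛ) (A r)) +
              ((qv r : ℝ) : ℂ) • (fermionEmbed (PolySite.incl hΛ) (A r) * (fermionEmbed (PolySite.incl hΛ) (A r))ᴴ)) +
          ∑ e ∈ gg, ((kap e : ℝ) : ℂ) • (G₀ e + ((tp i : ℝ) : ℂ) • GT e + ((U i : ℝ) : ℂ) • GD e)) +
        (∑ m' ∈ ah, ((dc i m' : ℝ) : ℂ) • ((V m')ᴴ - V m') + ∑ k ∈ wd, (a i k) • ladderWord (word k))) =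
      gramForm (∑ i ∈ I, ((w i : ℝ) : ℂ) • Λm i) O +
        (∑ k ∈ s, (Φb.localHamiltonian Λ' * fermionEmbed (PolySite.incl hΛ) (B k) -
            fermionEmbed (PolySite.incl hΛ) (B k) * Φb.localHamiltonian Λ') +
          ∑ l ∈ tt, (fermionEmbed (PolySite.incl (hsh l)) (fermionEmbed (PolySite.d4Emb (γ l) (wv l) Λ) (∑ i ∈ I, ((w i : ℝ) : ℂ) • Y i l)) -
            fermionEmbed (PolySite.incl hΛ) (∑ i ∈ I, ((w i : ℝ) : ℂ) • Y i l)) +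
          ∑ j ∈ uu, (∑ i ∈ I, ((w i : ℝ) : ℂ) * b i j) • ladderWord (cw j) +
          ∑ f ∈ ff, (relabel (Orb.spinSwap : Orb (PolySite Λ') ≃ Orb (PolySite Λ')) (∑ i ∈ I, ((w i : ℝ) : ℂ) • Yf i f) - (∑ i ∈ I, ((w i : ℝ) : ℂ) • Yf i f)) +
          ∑ z ∈ zz, (∑ i ∈ I, ((w i : ℝ) : ℂ) • Nz i z)) +
        (∑ r ∈ rr, ((lam r : ℝ) : ℂ) •
            (((β : ℝ) : ℂ) • ((fermionEmbed (PolySite.incl hΛ) (A r))ᴴ * (Φb.localHamiltonian Λ' * fermionEmbed (PolySite.incl hΛ) (A r) - fermionEmbed (PolySite.incl hΛ) (A r) * Φb.localHamiltonian Λ')) -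
              ((sv r : ℝ) : ℂ) • ((fermionEmbed (PolySite.incl hΛ) (A r))ᴴ * fermionEmbed (PolySite.incl hΛ) (A r)) +
              ((qv r : ℝ) : ℂ) • (fermionEmbed (PolySite.incl hΛ) (A r) * (fermionEmbed (PolySite.incl hΛ) (A r))ᴴ)) +
          ∑ e ∈ gg, ((kap e : ℝ) : ℂ) • (G₀ e + ((∑ i ∈ I, w i * tp i : ℝ) : ℂ) • GT e + ((∑ i ∈ I, w i * U i : ℝ) : ℂ) • GD e)) +
        (∑ m' ∈ ah, (((∑ i ∈ I, w i * dc i m') : ℝ) : ℂ) • ((V m')ᴴ - V m') + ∑ k ∈ wd, (∑ i ∈ I, ((w i : ℝ) : ℂ) * a i k) • ladderWord (word k)) := by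
    have Q1 : ∑ i ∈ I, ((w i : ℝ) : ℂ) • gramForm (Λm i) O =
        gramForm (∑ i ∈ I, ((w i : ℝ) : ℂ) • Λm i) O := (gramForm_sum_smul I _ Λm O).symm
    have Q2 : ∑ i ∈ I, ((w i : ℝ) : ℂ) • ∑ k ∈ s, (Hi i * fermionEmbed (PolySite.incl hΛ) (B k) - fermionEmbed (PolySite.incl hΛ) (B k) * Hi i) =
        ∑ k ∈ s, (Φb.localHamiltonian Λ' * fermionEmbed (PolySite.incl hΛ) (B k) -
          fermionEmbed (PolySite.incl hΛ) (B k) * Φb.localHamiltonian Λ') := by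
      simp_rw [Finset.smul_sum]
      rw [Finset.sum_comm]
      refine Finset.sum_congr rfl fun k _ => ?_
      have e1 : ∀ i, ((w i : ℝ) : ℂ) • (Hi i * fermionEmbed (PolySite.incl hΛ) (B k)) =
          (((w i : ℝ) : ℂ) • Hi i) * fermionEmbed (PolySite.incl hΛ) (B k) := fun i =>
        (smul_mul_assoc _ _ _).symm
      have e2 : ∀ i, ((w i : ℝ) : ℂ) • (fermionEmbed (PolySite.incl hΛ) (B k) * Hi i) =
          fermionEmbed (PolySite.incl hΛ) (B k) * (((w i : ℝ) : ℂ) • Hi i) := fun i =>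
        (mul_smul_comm _ _ _).symm
      simp_rw [smul_sub, e1, e2]
      rw [Finset.sum_sub_distrib, ← Finset.sum_mul, ← Finset.mul_sum, ← hH']
    have Q3 : ∑ i ∈ I, ((w i : ℝ) : ℂ) • ∑ l ∈ tt, (fermionEmbed (PolySite.incl (hsh l))
          (fermionEmbed (PolySite.d4Emb (γ l) (wv l) Λ) (Y i l)) - fermionEmbed (PolySite.incl hΛ) (Y i l)) =
        ∑ l ∈ tt, (fermionEmbed (PolySite.incl (hsh l))
          (fermionEmbed (PolySite.d4Emb (γ l) (wv l) Λ) (∑ i ∈ I, ((w i : ℝ) : ℂ) • Y i l)) -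
          fermionEmbed (PolySite.incl hΛ) (∑ i ∈ I, ((w i : ℝ) : ℂ) • Y i l)) := by
      simp_rw [Finset.smul_sum]
      rw [Finset.sum_comm]
      refine Finset.sum_congr rfl fun l _ => ?_
      simp_rw [smul_sub]
      rw [Finset.sum_sub_distrib, map_sum, map_sum, map_sum]
      congr 1
      · exact Finset.sum_congr rfl fun i _ => by rw [map_smul, map_smul]
      · exact Finset.sum_congr rfl fun i _ => by rw [map_smul]
    have Q4 : ∑ i ∈ I, ((w i : ℝ) : ℂ) • ∑ j ∈ uu, (b i j) • ladderWord (cw j) =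
        ∑ j ∈ uu, (∑ i ∈ I, ((w i : ℝ) : ℂ) * b i j) • ladderWord (cw j) := by
      simp_rw [Finset.smul_sum, smul_smul]
      rw [Finset.sum_comm]
      exact Finset.sum_congr rfl fun j _ => by rw [Finset.sum_smul]
    have Qf : ∑ i ∈ I, ((w i : ℝ) : ℂ) • ∑ f ∈ ff,
          (relabel (Orb.spinSwap : Orb (PolySite Λ') ≃ Orb (PolySite Λ')) (Yf i f) - (Yf i f)) =
        ∑ f ∈ ff, (relabel (Orb.spinSwap : Orb (PolySite Λ') ≃ Orb (PolySite Λ'))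
          (∑ i ∈ I, ((w i : ℝ) : ℂ) • Yf i f) - (∑ i ∈ I, ((w i : ℝ) : ℂ) • Yf i f)) := by
      simp_rw [Finset.smul_sum]
      rw [Finset.sum_comm]
      refine Finset.sum_congr rfl fun f _ => ?_
      simp_rw [smul_sub]
      rw [Finset.sum_sub_distrib, map_sum]
      congr 1
      exact Finset.sum_congr rfl fun i _ => by rw [map_smul]
    have Qz : ∑ i ∈ I, ((w i : ℝ) : ℂ) • ∑ z ∈ zz, (Nz i z) =
        ∑ z ∈ zz, (∑ i ∈ I, ((w i : ℝ) : ℂ) • Nz i z) := by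
      simp_rw [Finset.smul_sum]
      rw [Finset.sum_comm]
    have Qe : ∑ i ∈ I, ((w i : ℝ) : ℂ) • ∑ r ∈ rr, ((lam r : ℝ) : ℂ) •
            (((β : ℝ) : ℂ) • ((fermionEmbed (PolySite.incl hΛ) (A r))ᴴ * (Hi i * fermionEmbed (PolySite.incl hΛ) (A r) - fermionEmbed (PolySite.incl hΛ) (A r) * Hi i)) -
              ((sv r : ℝ) : ℂ) • ((fermionEmbed (PolySite.incl hΛ) (A r))ᴴ * fermionEmbed (PolySite.incl hΛ) (A r)) +
              ((qv r : ℝ) : ℂ) • (fermionEmbed (PolySite.incl hΛ) (A r) * (fermionEmbed (PolySite.incl hΛ) (A r))ᴴ)) =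
        ∑ r ∈ rr, ((lam r : ℝ) : ℂ) •
            (((β : ℝ) : ℂ) • ((fermionEmbed (PolySite.incl hΛ) (A r))ᴴ * (Φb.localHamiltonian Λ' * fermionEmbed (PolySite.incl hΛ) (A r) - fermionEmbed (PolySite.incl hΛ) (A r) * Φb.localHamiltonian Λ')) -
              ((sv r : ℝ) : ℂ) • ((fermionEmbed (PolySite.incl hΛ) (A r))ᴴ * fermionEmbed (PolySite.incl hΛ) (A r)) +
              ((qv r : ℝ) : ℂ) • (fermionEmbed (PolySite.incl hΛ) (A r) * (fermionEmbed (PolySite.incl hΛ) (A r))ᴴ)) := by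
      simp_rw [Finset.smul_sum]
      rw [Finset.sum_comm]
      refine Finset.sum_congr rfl fun r _ => ?_
      rw [sum_smul_eebRow I (fun i => ((w i : ℝ) : ℂ)) hw1C Hi (fermionEmbed (PolySite.incl hΛ) (A r))
        ((lam r : ℝ) : ℂ) ((β : ℝ) : ℂ) ((sv r : ℝ) : ℂ) ((qv r : ℝ) : ℂ), ← hH']
    have Qg : ∑ i ∈ I, ((w i : ℝ) : ℂ) • ∑ e ∈ gg, ((kap e : ℝ) : ℂ) • (G₀ e + ((tp i : ℝ) : ℂ) • GT e + ((U i : ℝ) : ℂ) • GD e) =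
        ∑ e ∈ gg, ((kap e : ℝ) : ℂ) • (G₀ e + ((∑ i ∈ I, w i * tp i : ℝ) : ℂ) • GT e + ((∑ i ∈ I, w i * U i : ℝ) : ℂ) • GD e) := by
      simp_rw [Finset.smul_sum]
      rw [Finset.sum_comm]
      refine Finset.sum_congr rfl fun e _ => ?_
      simp_rw [smul_comm ((w _ : ℝ) : ℂ) ((kap e : ℝ) : ℂ)]
      rw [← Finset.smul_sum, sum_smul_affineRow I (fun i => ((w i : ℝ) : ℂ)) hw1C
        (fun i => ((tp i : ℝ) : ℂ)) (fun i => ((U i : ℝ) : ℂ)) (G₀ e) (GT e) (GD e), htpC, hUC]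
    have Q5 : ∑ i ∈ I, ((w i : ℝ) : ℂ) • ∑ m' ∈ ah, ((dc i m' : ℝ) : ℂ) • ((V m')ᴴ - V m') =
        ∑ m' ∈ ah, (((∑ i ∈ I, w i * dc i m') : ℝ) : ℂ) • ((V m')ᴴ - V m') := by
      simp_rw [Finset.smul_sum, smul_smul]
      rw [Finset.sum_comm]
      refine Finset.sum_congr rfl fun m' _ => ?_
      rw [← Finset.sum_smul, Complex.ofReal_sum]
      simp_rw [Complex.ofReal_mul]
    have Q6 : ∑ i ∈ I, ((w i : ℝ) : ℂ) • ∑ k ∈ wd, (a i k) • ladderWord (word k) =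
        ∑ k ∈ wd, (∑ i ∈ I, ((w i : ℝ) : ℂ) * a i k) • ladderWord (word k) := by
      simp_rw [Finset.smul_sum, smul_smul]
      rw [Finset.sum_comm]
      exact Finset.sum_congr rfl fun k _ => by rw [Finset.sum_smul]
    have hdist2 : ∀ i ∈ I, ((w i : ℝ) : ℂ) • (gramForm (Λm i) O +
        (∑ k ∈ s, (Hi i * fermionEmbed (PolySite.incl hΛ) (B k) - fermionEmbed (PolySite.incl hΛ) (B k) * Hi i) +
          ∑ l ∈ tt, (fermionEmbed (PolySite.incl (hsh l)) (fermionEmbed (PolySite.d4Emb (γ l) (wv l) Λ) (Y i l)) -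
            fermionEmbed (PolySite.incl hΛ) (Y i l)) +
          ∑ j ∈ uu, (b i j) • ladderWord (cw j) +
          ∑ f ∈ ff, (relabel (Orb.spinSwap : Orb (PolySite Λ') ≃ Orb (PolySite Λ')) (Yf i f) - (Yf i f)) +
          ∑ z ∈ zz, (Nz i z)) +
        (∑ r ∈ rr, ((lam r : ℝ) : ℂ) •
            (((β : ℝ) : ℂ) • ((fermionEmbed (PolySite.incl hΛ) (A r))ᴴ * (Hi i * fermionEmbed (PolySite.incl hΛ) (A r) - fermionEmbed (PolySite.incl hΛ) (A r) * Hi i)) -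
              ((sv r : ℝ) : ℂ) • ((fermionEmbed (PolySite.incl hΛ) (A r))ᴴ * fermionEmbed (PolySite.incl hΛ) (A r)) +
              ((qv r : ℝ) : ℂ) • (fermionEmbed (PolySite.incl hΛ) (A r) * (fermionEmbed (PolySite.incl hΛ) (A r))ᴴ)) +
          ∑ e ∈ gg, ((kap e : ℝ) : ℂ) • (G₀ e + ((tp i : ℝ) : ℂ) • GT e + ((U i : ℝ) : ℂ) • GD e)) +
        (∑ m' ∈ ah, ((dc i m' : ℝ) : ℂ) • ((V m')ᴴ - V m') + ∑ k ∈ wd, (a i k) • ladderWord (word k))) =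
      ((w i : ℝ) : ℂ) • gramForm (Λm i) O +
        (((w i : ℝ) : ℂ) • ∑ k ∈ s, (Hi i * fermionEmbed (PolySite.incl hΛ) (B k) - fermionEmbed (PolySite.incl hΛ) (B k) * Hi i) +
          ((w i : ℝ) : ℂ) • ∑ l ∈ tt, (fermionEmbed (PolySite.incl (hsh l)) (fermionEmbed (PolySite.d4Emb (γ l) (wv l) Λ) (Y i l)) -
            fermionEmbed (PolySite.incl hΛ) (Y i l)) +
          ((w i : ℝ) : ℂ) • ∑ j ∈ uu, (b i j) • ladderWord (cw j) +
          ((w i : ℝ) : ℂ) • ∑ f ∈ ff, (relabel (Orb.spinSwap : Orb (PolySite Λ') ≃ Orb (PolySite Λ')) (Yf i f) - (Yf i f)) +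
          ((w i : ℝ) : ℂ) • ∑ z ∈ zz, (Nz i z)) +
        (((w i : ℝ) : ℂ) • ∑ r ∈ rr, ((lam r : ℝ) : ℂ) •
            (((β : ℝ) : ℂ) • ((fermionEmbed (PolySite.incl hΛ) (A r))ᴴ * (Hi i * fermionEmbed (PolySite.incl hΛ) (A r) - fermionEmbed (PolySite.incl hΛ) (A r) * Hi i)) -
              ((sv r : ℝ) : ℂ) • ((fermionEmbed (PolySite.incl hΛ) (A r))ᴴ * fermionEmbed (PolySite.incl hΛ) (A r)) +
              ((qv r : ℝ) : ℂ) • (fermionEmbed (PolySite.incl hΛ) (A r) * (fermionEmbed (PolySite.incl hΛ) (A r))ᴴ)) +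
          ((w i : ℝ) : ℂ) • ∑ e ∈ gg, ((kap e : ℝ) : ℂ) • (G₀ e + ((tp i : ℝ) : ℂ) • GT e + ((U i : ℝ) : ℂ) • GD e)) +
        (((w i : ℝ) : ℂ) • ∑ m' ∈ ah, ((dc i m' : ℝ) : ℂ) • ((V m')ᴴ - V m') +
          ((w i : ℝ) : ℂ) • ∑ k ∈ wd, (a i k) • ladderWord (word k)) := by
      intro i _
      module
    rw [Finset.sum_congr rfl hdist2]
    simp only [Finset.sum_add_distrib]
    rw [Q1, Q2, Q3, Q4, Qf, Qz, Qe, Qg, Q5, Q6]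
  -- §C the combined identity, and the reader at the barycentre
  have hs : ∑ i ∈ I, ((w i : ℝ) : ℂ) • (Xw - ((c i : ℝ) : ℂ) • (1 : FermionOp Λ') -
        ∑ σ : Fin 2, ((μ i σ : ℝ) : ℂ) • (nAt 0 hz σ - ((ν : ℝ) : ℂ) • (1 : FermionOp Λ')) -
        ((κ : ℝ) : ℂ) • (((u i : ℝ) : ℂ) • (1 : FermionOp Λ') - fermionEmbed (PolySite.incl h0) (Ei i))) =
      ∑ i ∈ I, ((w i : ℝ) : ℂ) • (gramForm (Λm i) O +
        (∑ k ∈ s, (Hi i * fermionEmbed (PolySite.incl hΛ) (B k) - fermionEmbed (PolySite.incl hΛ) (B k) * Hi i) +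
          ∑ l ∈ tt, (fermionEmbed (PolySite.incl (hsh l)) (fermionEmbed (PolySite.d4Emb (γ l) (wv l) Λ) (Y i l)) -
            fermionEmbed (PolySite.incl hΛ) (Y i l)) +
          ∑ j ∈ uu, (b i j) • ladderWord (cw j) +
          ∑ f ∈ ff, (relabel (Orb.spinSwap : Orb (PolySite Λ') ≃ Orb (PolySite Λ')) (Yf i f) - (Yf i f)) +
          ∑ z ∈ zz, (Nz i z)) +
        (∑ r ∈ rr, ((lam r : ℝ) : ℂ) •
            (((β : ℝ) : ℂ) • ((fermionEmbed (PolySite.incl hΛ) (A r))ᴴ * (Hi i * fermionEmbed (PolySite.incl hΛ) (A r) - fermionEmbed (PolySite.incl hΛ) (A r) * Hi i)) -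
              ((sv r : ℝ) : ℂ) • ((fermionEmbed (PolySite.incl hΛ) (A r))ᴴ * fermionEmbed (PolySite.incl hΛ) (A r)) +
              ((qv r : ℝ) : ℂ) • (fermionEmbed (PolySite.incl hΛ) (A r) * (fermionEmbed (PolySite.incl hΛ) (A r))ᴴ)) +
          ∑ e ∈ gg, ((kap e : ℝ) : ℂ) • (G₀ e + ((tp i : ℝ) : ℂ) • GT e + ((U i : ℝ) : ℂ) • GD e)) +
        (∑ m' ∈ ah, ((dc i m' : ℝ) : ℂ) • ((V m')ᴴ - V m') + ∑ k ∈ wd, (a i k) • ladderWord (word k))) :=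
    Finset.sum_congr rfl fun i hi => by rw [hcert i hi]
  rw [hl, hr] at hs
  have hnull' : ∀ z ∈ zz, ω.expect Λ' ((fun z => ∑ i ∈ I, ((w i : ℝ) : ℂ) • Nz i z) z) = 0 := by
    intro z hz'
    beta_reduce
    rw [map_sum]
    exact Finset.sum_eq_zero fun i hi => by rw [map_smul, hnull i hi z hz', smul_zero]
  have hmain := h.re_expect_ge_of_thermal_certificate_symm_TT'_of_sectorGibbs t (∑ i ∈ I, w i * tp i)
    (∑ i ∈ I, w i * U i) hn0 hn2 β hLs hΛ h8 h0 hz Xw κ (∑ i ∈ I, w i * u i) (fun σ => ∑ i ∈ I, w i * μ i σ) ν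
    hΛbar O s B tt γ wv hsh (fun l => ∑ i ∈ I, ((w i : ℝ) : ℂ) • Y i l) uu
    (fun j => ∑ i ∈ I, ((w i : ℝ) : ℂ) * b i j) cw hcw ff (fun f => ∑ i ∈ I, ((w i : ℝ) : ℂ) • Yf i f) zz
    (fun z => ∑ i ∈ I, ((w i : ℝ) : ℂ) • Nz i z) hnull' rr lam hlam A hAN hAS sv qv hq gg kap hkap
    (fun e => G₀ e + ((∑ i ∈ I, w i * tp i : ℝ) : ℂ) • GT e + ((∑ i ∈ I, w i * U i : ℝ) : ℂ) • GD e) hG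
    ah (fun m' => ∑ i ∈ I, w i * dc i m') V wd (fun k => ∑ i ∈ I, ((w i : ℝ) : ℂ) * a i k) word
    (c := ∑ i ∈ I, w i * c i) hs
  simpa using hmain

/-- **Weighted-corner form** (what a box evaluator uses): under the same hypotheses, the weighted
mean of the CORNER bounds is a bound at the barycentre,
`Σ wᵢ (cᵢ − Σₖ ‖aᵢₖ‖ + (Σ_σ μᵢσ)(n/2 − ν) + κ(uᵢ − e^{t t̄' Ū}(ω))) ≤ Re ω_{Λ'}(Xw)` (`‖Σ wᵢ aᵢₖ‖ ≤ Σ wᵢ ‖aᵢₖ‖`).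
[cite: FawziFawziScalet2024, Thm. 3.6] [cite: WangEtAl2024, §III] -/
theorem IsTorusLimitOfMixture.re_expect_ge_of_thermal_certificates_convexComb_symm_TT'_weighted_of_sectorGibbs
    (t : ℝ) {ι₀ : Type*} (I : Finset ι₀) (w : ι₀ → ℝ) (hw0 : ∀ i ∈ I, 0 ≤ w i)
    (hw1 : ∑ i ∈ I, w i = 1) (tp U u c : ι₀ → ℝ)
    {n : ℝ} (hn0 : 0 ≤ n) (hn2 : n ≤ 2) (β : ℝ)
    {ω : InfVolFermionState 2} {Ls : ℕ → ℕ}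
    (h : ω.IsTorusLimitOfMixture (sectorGibbsCount n)
      (fun L => sectorGibbsWeightTT' β t (∑ i ∈ I, w i * tp i) (∑ i ∈ I, w i * U i) n L)
      (fun L => sectorGibbsVectorTT' t (∑ i ∈ I, w i * tp i) (∑ i ∈ I, w i * U i) n L) Ls)
    (hLs : Tendsto Ls atTop atTop)
    {Λ Λ' : Finset (Site 2)} (hΛ : Λ ⊆ Λ') (h8 : thicken Λ 1 ⊆ Λ')
    (h0 : thicken ({0} : Finset (Site 2)) 1 ⊆ Λ') (hz : (0 : Site 2) ∈ Λ')
    (Xw : FermionOp Λ') (κ : ℝ) (μ : ι₀ → Fin 2 → ℝ) (ν : ℝ)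
    {m : Type*} [Fintype m] [DecidableEq m] (Λm : ι₀ → Matrix m m ℂ)
    (hΛm : ∀ i ∈ I, (Λm i).PosSemidef) (O : m → FermionOp Λ')
    {κ' : Type*} (s : Finset κ') (B : κ' → FermionOp Λ)
    {ι : Type*} (tt : Finset ι) (γ : ι → DihedralGroup 4) (wv : ι → Site 2)
    (hsh : ∀ l, d4ShiftSet (γ l) (wv l) Λ ⊆ Λ') (Y : ι₀ → ι → FermionOp Λ)
    {ρ : Type*} (uu : Finset ρ) (b : ι₀ → ρ → ℂ) (cw : ρ → List (Orb (PolySite Λ') × Bool))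
    (hcw : ∀ j ∈ uu, ladderCharge (cw j) ≠ 0 ∨ ladderSpinCharge (cw j) ≠ 0)
    {φ : Type*} (ff : Finset φ) (Yf : ι₀ → φ → FermionOp Λ')
    {ζ : Type*} (zz : Finset ζ) (Nz : ι₀ → ζ → FermionOp Λ')
    (hnull : ∀ i ∈ I, ∀ z ∈ zz, ω.expect Λ' (Nz i z) = 0)
    {θ : Type*} (rr : Finset θ) (lam : θ → ℝ) (hlam : ∀ r ∈ rr, 0 ≤ lam r) (A : θ → FermionOp Λ)
    (hAN : ∀ r ∈ rr, Commute (A r) (totalNumber : FermionOp Λ))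
    (hAS : ∀ r ∈ rr, Commute (A r) (HubbardWave0.spinZ : FermionOp Λ))
    (sv qv : θ → ℝ) (hq : ∀ r ∈ rr, Real.exp (sv r - 1) ≤ qv r)
    {η : Type*} (gg : Finset η) (kap : η → ℝ) (hkap : ∀ e ∈ gg, 0 ≤ kap e) (G₀ GT GD : η → FermionOp Λ')
    (hG : ∀ e ∈ gg, 0 ≤ (ω.expect Λ'
      (G₀ e + (((∑ i ∈ I, w i * tp i) : ℝ) : ℂ) • GT e + (((∑ i ∈ I, w i * U i) : ℝ) : ℂ) • GD e)).re)
    {δ : Type*} (ah : Finset δ) (dc : ι₀ → δ → ℝ) (V : δ → FermionOp Λ')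
    {κ'' : Type*} (wd : Finset κ'') (a : ι₀ → κ'' → ℂ)
    (word : κ'' → List (Orb (PolySite Λ') × Bool))
    (hcert : ∀ i ∈ I, Xw - ((c i : ℝ) : ℂ) • (1 : FermionOp Λ') -
        ∑ σ : Fin 2, ((μ i σ : ℝ) : ℂ) • (nAt 0 hz σ - ((ν : ℝ) : ℂ) • (1 : FermionOp Λ')) -
        ((κ : ℝ) : ℂ) • (((u i : ℝ) : ℂ) • (1 : FermionOp Λ') -
          fermionEmbed (PolySite.incl h0) ((hubbardTTPrimeFermionInteraction t (tp i) (U i)).meanEnergyObs 1)) =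
      gramForm (Λm i) O +
        (∑ k ∈ s, ((hubbardTTPrimeFermionInteraction t (tp i) (U i)).localHamiltonian Λ' * fermionEmbed (PolySite.incl hΛ) (B k) - fermionEmbed (PolySite.incl hΛ) (B k) * (hubbardTTPrimeFermionInteraction t (tp i) (U i)).localHamiltonian Λ') +
          ∑ l ∈ tt, (fermionEmbed (PolySite.incl (hsh l)) (fermionEmbed (PolySite.d4Emb (γ l) (wv l) Λ) (Y i l)) -
            fermionEmbed (PolySite.incl hΛ) (Y i l)) +
          ∑ j ∈ uu, (b i j) • ladderWord (cw j) +
          ∑ f ∈ ff, (relabel (Orb.spinSwap : Orb (PolySite Λ') ≃ Orb (PolySite Λ')) (Yf i f) - (Yf i f)) +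
          ∑ z ∈ zz, (Nz i z)) +
        (∑ r ∈ rr, ((lam r : ℝ) : ℂ) •
            (((β : ℝ) : ℂ) • ((fermionEmbed (PolySite.incl hΛ) (A r))ᴴ *
                ((hubbardTTPrimeFermionInteraction t (tp i) (U i)).localHamiltonian Λ' * fermionEmbed (PolySite.incl hΛ) (A r) - fermionEmbed (PolySite.incl hΛ) (A r) * (hubbardTTPrimeFermionInteraction t (tp i) (U i)).localHamiltonian Λ')) -
              ((sv r : ℝ) : ℂ) • ((fermionEmbed (PolySite.incl hΛ) (A r))ᴴ * fermionEmbed (PolySite.incl hΛ) (A r)) +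
              ((qv r : ℝ) : ℂ) • (fermionEmbed (PolySite.incl hΛ) (A r) * (fermionEmbed (PolySite.incl hΛ) (A r))ᴴ)) +
          ∑ e ∈ gg, ((kap e : ℝ) : ℂ) • (G₀ e + ((tp i : ℝ) : ℂ) • GT e + ((U i : ℝ) : ℂ) • GD e)) +
        (∑ m' ∈ ah, ((dc i m' : ℝ) : ℂ) • ((V m')ᴴ - V m') + ∑ k ∈ wd, (a i k) • ladderWord (word k))) :
    ∑ i ∈ I, w i * (c i - ∑ k ∈ wd, ‖a i k‖ + (∑ σ : Fin 2, μ i σ) * (n / 2 - ν) +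
        κ * (u i - ω.meanEnergy (hubbardTTPrimeFermionInteraction t (∑ i ∈ I, w i * tp i) (∑ i ∈ I, w i * U i)) 1)) ≤
      (ω.expect Λ' Xw).re := by
  have h' := h.re_expect_ge_of_thermal_certificates_convexComb_symm_TT'_of_sectorGibbs t I w hw0 hw1 tp U u c
    hn0 hn2 β hLs hΛ h8 h0 hz Xw κ μ ν Λm hΛm O s B tt γ wv hsh Y uu b cw hcw ff Yf zz Nz hnull rr lam hlam A hAN hAS sv qv hq gg kap hkap G₀ GT GD hG ah dc V wd a word hcert
  -- `‖Σ w a‖ ≤ Σ w ‖a‖`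
  have htri : ∑ k ∈ wd, ‖∑ i ∈ I, ((w i : ℝ) : ℂ) * a i k‖ ≤
      ∑ k ∈ wd, ∑ i ∈ I, w i * ‖a i k‖ := by
    refine Finset.sum_le_sum fun k _ => (norm_sum_le _ _).trans (Finset.sum_le_sum fun i hi => ?_)
    rw [norm_mul, Complex.norm_real, Real.norm_of_nonneg (hw0 i hi)]
  -- rearrange the weighted corner bounds
  set eb := ω.meanEnergy (hubbardTTPrimeFermionInteraction t (∑ i ∈ I, w i * tp i) (∑ i ∈ I, w i * U i)) 1 with heb
  have hre : ∑ i ∈ I, w i * (c i - ∑ k ∈ wd, ‖a i k‖ + (∑ σ : Fin 2, μ i σ) * (n / 2 - ν) +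
        κ * (u i - eb)) =
      ∑ i ∈ I, w i * c i - ∑ k ∈ wd, ∑ i ∈ I, w i * ‖a i k‖ +
        (∑ σ : Fin 2, ∑ i ∈ I, w i * μ i σ) * (n / 2 - ν) +
        κ * (∑ i ∈ I, w i * u i - eb) := by
    have e1 : ∀ i, w i * (c i - ∑ k ∈ wd, ‖a i k‖ + (∑ σ : Fin 2, μ i σ) * (n / 2 - ν) + κ * (u i - eb)) =
        w i * c i - ∑ k ∈ wd, w i * ‖a i k‖ + ∑ σ : Fin 2, w i * μ i σ * (n / 2 - ν) +
          (κ * (w i * u i) - κ * eb * w i) := by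
      intro i
      rw [mul_add, mul_add, mul_sub, Finset.mul_sum, Finset.sum_mul, Finset.mul_sum]
      simp_rw [mul_assoc]
      ring
    simp_rw [e1]
    rw [Finset.sum_add_distrib, Finset.sum_add_distrib, Finset.sum_sub_distrib,
      Finset.sum_comm (s := I) (t := wd)]
    have e2 : ∑ i ∈ I, (κ * (w i * u i) - κ * eb * w i) = κ * (∑ i ∈ I, w i * u i - eb) := by
      rw [Finset.sum_sub_distrib, ← Finset.mul_sum, ← Finset.mul_sum, hw1]
      ring
    rw [e2]
    congr 2
    rw [Finset.sum_mul, Finset.sum_comm]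
    exact Finset.sum_congr rfl fun σ _ => by rw [Finset.sum_mul]
  rw [hre]
  linarith

/-- **Thermal box certificate at a prescribed target `(t', U')`** (the calling convention of a box
evaluator: the target and the two barycentre identities `Σ wᵢ t'ᵢ = t'`, `Σ wᵢ Uᵢ = U'` are supplied),
weighted-corner form. [cite: FawziFawziScalet2024, Thm. 3.6] [cite: WangEtAl2024, §III] -/
theorem IsTorusLimitOfMixture.re_expect_ge_of_thermal_certificates_convexComb_symm_TT'_weighted_at_of_sectorGibbs
    (t t' U' : ℝ) {ι₀ : Type*} (I : Finset ι₀) (w : ι₀ → ℝ) (hw0 : ∀ i ∈ I, 0 ≤ w i)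
    (hw1 : ∑ i ∈ I, w i = 1) (tp U u c : ι₀ → ℝ)
    (htp : ∑ i ∈ I, w i * tp i = t') (hUU : ∑ i ∈ I, w i * U i = U')
    {n : ℝ} (hn0 : 0 ≤ n) (hn2 : n ≤ 2) (β : ℝ)
    {ω : InfVolFermionState 2} {Ls : ℕ → ℕ}
    (h : ω.IsTorusLimitOfMixture (sectorGibbsCount n)
      (fun L => sectorGibbsWeightTT' β t t' U' n L)
      (fun L => sectorGibbsVectorTT' t t' U' n L) Ls)
    (hLs : Tendsto Ls atTop atTop)
    {Λ Λ' : Finset (Site 2)} (hΛ : Λ ⊆ Λ') (h8 : thicken Λ 1 ⊆ Λ')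
    (h0 : thicken ({0} : Finset (Site 2)) 1 ⊆ Λ') (hz : (0 : Site 2) ∈ Λ')
    (Xw : FermionOp Λ') (κ : ℝ) (μ : ι₀ → Fin 2 → ℝ) (ν : ℝ)
    {m : Type*} [Fintype m] [DecidableEq m] (Λm : ι₀ → Matrix m m ℂ)
    (hΛm : ∀ i ∈ I, (Λm i).PosSemidef) (O : m → FermionOp Λ')
    {κ' : Type*} (s : Finset κ') (B : κ' → FermionOp Λ)
    {ι : Type*} (tt : Finset ι) (γ : ι → DihedralGroup 4) (wv : ι → Site 2)
    (hsh : ∀ l, d4ShiftSet (γ l) (wv l) Λ ⊆ Λ') (Y : ι₀ → ι → FermionOp Λ)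
    {ρ : Type*} (uu : Finset ρ) (b : ι₀ → ρ → ℂ) (cw : ρ → List (Orb (PolySite Λ') × Bool))
    (hcw : ∀ j ∈ uu, ladderCharge (cw j) ≠ 0 ∨ ladderSpinCharge (cw j) ≠ 0)
    {φ : Type*} (ff : Finset φ) (Yf : ι₀ → φ → FermionOp Λ')
    {ζ : Type*} (zz : Finset ζ) (Nz : ι₀ → ζ → FermionOp Λ')
    (hnull : ∀ i ∈ I, ∀ z ∈ zz, ω.expect Λ' (Nz i z) = 0)
    {θ : Type*} (rr : Finset θ) (lam : θ → ℝ) (hlam : ∀ r ∈ rr, 0 ≤ lam r) (A : θ → FermionOp Λ)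
    (hAN : ∀ r ∈ rr, Commute (A r) (totalNumber : FermionOp Λ))
    (hAS : ∀ r ∈ rr, Commute (A r) (HubbardWave0.spinZ : FermionOp Λ))
    (sv qv : θ → ℝ) (hq : ∀ r ∈ rr, Real.exp (sv r - 1) ≤ qv r)
    {η : Type*} (gg : Finset η) (kap : η → ℝ) (hkap : ∀ e ∈ gg, 0 ≤ kap e) (G₀ GT GD : η → FermionOp Λ')
    (hG : ∀ e ∈ gg, 0 ≤ (ω.expect Λ'
      (G₀ e + ((t' : ℝ) : ℂ) • GT e + ((U' : ℝ) : ℂ) • GD e)).re)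
    {δ : Type*} (ah : Finset δ) (dc : ι₀ → δ → ℝ) (V : δ → FermionOp Λ')
    {κ'' : Type*} (wd : Finset κ'') (a : ι₀ → κ'' → ℂ)
    (word : κ'' → List (Orb (PolySite Λ') × Bool))
    (hcert : ∀ i ∈ I, Xw - ((c i : ℝ) : ℂ) • (1 : FermionOp Λ') -
        ∑ σ : Fin 2, ((μ i σ : ℝ) : ℂ) • (nAt 0 hz σ - ((ν : ℝ) : ℂ) • (1 : FermionOp Λ')) -
        ((κ : ℝ) : ℂ) • (((u i : ℝ) : ℂ) • (1 : FermionOp Λ') -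
          fermionEmbed (PolySite.incl h0) ((hubbardTTPrimeFermionInteraction t (tp i) (U i)).meanEnergyObs 1)) =
      gramForm (Λm i) O +
        (∑ k ∈ s, ((hubbardTTPrimeFermionInteraction t (tp i) (U i)).localHamiltonian Λ' * fermionEmbed (PolySite.incl hΛ) (B k) - fermionEmbed (PolySite.incl hΛ) (B k) * (hubbardTTPrimeFermionInteraction t (tp i) (U i)).localHamiltonian Λ') +
          ∑ l ∈ tt, (fermionEmbed (PolySite.incl (hsh l)) (fermionEmbed (PolySite.d4Emb (γ l) (wv l) Λ) (Y i l)) -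
            fermionEmbed (PolySite.incl hΛ) (Y i l)) +
          ∑ j ∈ uu, (b i j) • ladderWord (cw j) +
          ∑ f ∈ ff, (relabel (Orb.spinSwap : Orb (PolySite Λ') ≃ Orb (PolySite Λ')) (Yf i f) - (Yf i f)) +
          ∑ z ∈ zz, (Nz i z)) +
        (∑ r ∈ rr, ((lam r : ℝ) : ℂ) •
            (((β : ℝ) : ℂ) • ((fermionEmbed (PolySite.incl hΛ) (A r))ᴴ *
                ((hubbardTTPrimeFermionInteraction t (tp i) (U i)).localHamiltonian Λ' * fermionEmbed (PolySite.incl hΛ) (A r) - fermionEmbed (PolySite.incl hΛ) (A r) * (hubbardTTPrimeFermionInteraction t (tp i) (U i)).localHamiltonian Λ')) -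
              ((sv r : ℝ) : ℂ) • ((fermionEmbed (PolySite.incl hΛ) (A r))ᴴ * fermionEmbed (PolySite.incl hΛ) (A r)) +
              ((qv r : ℝ) : ℂ) • (fermionEmbed (PolySite.incl hΛ) (A r) * (fermionEmbed (PolySite.incl hΛ) (A r))ᴴ)) +
          ∑ e ∈ gg, ((kap e : ℝ) : ℂ) • (G₀ e + ((tp i : ℝ) : ℂ) • GT e + ((U i : ℝ) : ℂ) • GD e)) +
        (∑ m' ∈ ah, ((dc i m' : ℝ) : ℂ) • ((V m')ᴴ - V m') + ∑ k ∈ wd, (a i k) • ladderWord (word k))) :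
    ∑ i ∈ I, w i * (c i - ∑ k ∈ wd, ‖a i k‖ + (∑ σ : Fin 2, μ i σ) * (n / 2 - ν) +
        κ * (u i - ω.meanEnergy (hubbardTTPrimeFermionInteraction t t' U') 1)) ≤
      (ω.expect Λ' Xw).re := by
  subst htp hUU
  exact h.re_expect_ge_of_thermal_certificates_convexComb_symm_TT'_weighted_of_sectorGibbs t I w hw0 hw1 tp U
    u c hn0 hn2 β hLs hΛ h8 h0 hz Xw κ μ ν Λm hΛm O s B tt γ wv hsh Y uu b cw hcw ff Yf zz Nz hnull rr lam hlam A hAN hAS sv qv hq gg kap hkap G₀ GT GD hG ah dc V wd a word hcert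

end InfVolFermionState

end Literature.MathematicalPhysics.QuantumLattice

end
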